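import Literature.MathematicalPhysics.QuantumFieldTheory.Balaban1983to89.UnitaryModel
import Summits.QuantumFields.Balaban3D.Carriers.Masses
import Summits.QuantumFields.Balaban3D.Proofs.Transport48

/-!
# `Summit.QuantumFields.Balaban3D.Proofs.Bound55Masses` — the two STRUCTURAL hypotheses of `…Proofs.Bound55Tower` /
# `…Proofs.Transport48.transport41_le_sum_ae` DISCHARGED for the lane's CONSTRUCTED masses (seat p1's `Carriers.Masses.histWeights3`,
# ruling R-MASS ✓, v1.2 pins): the mass domination `hm₁` (from `massRec_succ`/`massRec_triv`) and the decomposition-of-unity covering `hcover` (print's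
# (7)–(8) p. 257–258 at scale k: «the» large-field set `P_k(U) = {p ⊂ Ω_k : |U(∂p) − 1| ≥ ε}` carries weight 1) — lane `pub-balaban3d`,
# seat p4 (LEAF-LEDGER C1)

HONEST FRAMING (lane PLAN.md §0, binding): see `…Proofs.SectAFirstStep`.  [folklore] bookkeeping over seat p1's carriers; nothing of
[Balaban1985UV3] is asserted.

WHAT IS PRINTED. (7)–(8) p. 257 L28–p. 258 L3 (render p003/p004): «we introduce a decomposition of unity 1 = Π_{p⊂T₁}
[ζ({|U(∂p) − 1| ≥ ε₁}) + χ({|U(∂p) − 1| < ε₁})] = Σ_{P⊂T₁} ζ_P χ_{Pᶜ} (7) … (8)»; p. 267 L36–p. 268 L4 «We introduce the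
decomposition of unity (7) for the field V on the domain Λ_k, with ε₁ = g_kp(g_k) … We change the definition of Λ_k, taking
Λ_k = Ω_k∖Ω_{k+1}».  The lane's carrier (seat p1, R-HIST′/D-41′) splits the small-field factor `χ_{Pᶜ}` into the part on the new
`Λ_k(h′)` (inside the step weight `stepWeight`, threshold `εS k` = print's (40) `χ_k`) and the part inside `B(Λ_{k+1}(h′)) = Ω_{k+1}(h′)` (the
factor `χ` of (49), here `chiB`), with the large-field threshold `εL k`; the covering needs only `εL k ≤ εS k`.  v5 (seat p4 gen-3, FINDING
2026-08-22 `…Proofs.FibreClash`): the `chiB` consumed by the covering and by C1 is taken AT THE DECOMPOSITION-OF-UNITY THRESHOLD `εL k = g_kp(g_k)`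
of the step (p. 267 L36–37 «with ε₁ = g_kp(g_k)»; p. 268 L13–15 «χ denotes characteristics functions in the decomposition of unity, restricted to
B(Λ_{k+1})») — NOT at `εS k` as in v1–v4: with `εS` the residual pair {R3D-01 at the trivial history, R3D-02} of a step is jointly
unsatisfiable (`FibreClash.ae_small_of_transported_pair` at `ε' := epsSOf S K`).  `chiB` itself stays threshold-parametric.

WHAT THIS FILE PROVES (no `sorry`, axioms standard):
* `chiB` — the small-field factor inside `B(Λ_{k+1}(h′))` as a `{0,1}`-valued density (`chiB_nonneg`, `chiB_le_one`; §3 `measurable_chiB`,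
  `measurable_stepWeight`);
* `stepWeight_mul_chiB_cover` — **`hcover` DISCHARGED**: for an admissible `h` and ANY configuration `U`, the history `h′ = h ⌢ P_k(U)`
  with `P_k(U)` = the large plaquettes inside `Ω_k(h)` has `stepWeight·chiB = 1` (`chiB` at `εL k`; needs `εL k ≤ εS k`); `histWeights3_cover` — the form
  consumed by `transport41_le_sum_ae`/`Bound55Tower` (inadmissible `h` have mass `0`);
* `histWeights3_transport_le_mass_ae` — **`hm₁` DISCHARGED**: `T_k[stepWeight(h′)·m_k(proj h′)] ≤ m_{k+1}(h′)` dV-a.e. for EVERY `h′`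
  under Haar-compatibility of `Ū_k` (E6′) (trivial history: seat p1's pins `stepWeight_triv`/`massRec_triv` and `T1 = 1`; admissible:
  `massRec_succ` and `T[w·m] ≤ 1`; inadmissible: both sides vanish a.e., `Measure.rnDeriv_zero`);
  `histWeights3_mass_succ_ae_of_map` — the UNTRUNCATED printed recursion `m_{k+1}(h′) = T_k[w·m_k]` a.e. for admissible non-trivial
  `h′` (ruling R-HAAR (2): the `min 1` pin carries no content); `histWeights3_transport_triv_ae_eq_one` — `T_k[w(triv)·m_k(triv)] = 1` a.e.
  (R-HAAR (3): the trivial-history pin `m(triv) := 1` modifies a null set).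
-/

noncomputable section

namespace Summit.QuantumFields.Balaban3D.Proofs.Bound55Masses

open _root_.MeasureTheory
open Literature.MathematicalPhysics.QuantumFieldTheory.Balaban1983to89
open Literature.MathematicalPhysics.QuantumFieldTheory.Balaban1983to89.AveragingRT (rnTransport rnDensity pushDensity)
open Summit.QuantumFields.Balaban3D.Carriers

variable {P : Params} {G : Type} [GaugeGroup G] (M₁ : ℕ) (Rcol : ℕ → ℕ) (εL εS : ℕ → ℝ)

/-! ## §1 The small-field factor inside `B(Λ_{k+1})` -/

open Classical in
/-- The factor «χ» of **(49)** p. 268 (R-b edition, route owner RULING g20-№2 (A), gap G-α55-1): small field (`|U(∂p) − 1| < εS k`) on every plaquette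
`p ∉ P_k` covered by the CURRENT top region `Ω_k(h) = Ω_k(h′)` (seat p1's `Carriers.Omega … (k+1) h′ k`; print's decomposition of unity (7) «for the field V on the
domain Λ_k^{(k)}», p.267 — every non-`P_k` plaquette of `Ω_k^{(k)}` carries the small-field factor; the former edition asked it only under `Ω_{k+1}(h′)`,
leaving the `∂Ω_{k+1}(h′)`-straddlers free), as a `{0,1}`-valued density of the scale-`k` field.  `chiB` only DECREASED: every consumer bound survives.
[cite: Balaban1985UV3, (7) p.257 + (49) p.268] -/
def chiB (k : ℕ) (h' : Hist P (k + 1)) (U : GaugeField P k G) : ℝ :=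
  if ∀ p : Plaq P k, p ∉ h'.last → plaqCover p ⊆ Omega M₁ Rcol (k + 1) h' k →
      dist1 (GaugeField.plaqHol U p) < εS k then 1 else 0

/-- `0 ≤ chiB`. [folklore] -/
theorem chiB_nonneg (k : ℕ) (h' : Hist P (k + 1)) (U : GaugeField P k G) : 0 ≤ chiB M₁ Rcol εS k h' U := by
  unfold chiB; split_ifs <;> norm_num

/-- `chiB ≤ 1`. [folklore] -/
theorem chiB_le_one (k : ℕ) (h' : Hist P (k + 1)) (U : GaugeField P k G) : chiB M₁ Rcol εS k h' U ≤ 1 := by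
  unfold chiB; split_ifs <;> norm_num

/-! ## §2 The covering: «the» large-field set of a configuration carries weight one -/

open Classical in
/-- **«THE» LARGE-FIELD SET** of a configuration at the passage `k → k+1` above the admissible history `h`: the plaquettes of
`Ω_k(h)` with `|U(∂p) − 1| ≥ εL k` — print's `P` of (7)–(8) p. 257–258 («ζ({|U(∂p) − 1| ≥ ε₁})») inside «the domain Λ_k» of
p. 267 L36. [cite: Balaban1985UV3, (7) p.257 + p.267 L36] -/
def largeSet (k : ℕ) (h : Hist P k) (U : GaugeField P k G) : Finset (Plaq P k) :=
  Finset.univ.filter fun p => plaqCover p ⊆ Omega M₁ Rcol k h k ∧ εL k ≤ dist1 (GaugeField.plaqHol U p)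

open Classical in
/-- **THE DECOMPOSITION-OF-UNITY COVERING (7)–(8) AT SCALE k** (the `hcover` of `Transport48.transport41_le_sum_ae`): for an
admissible history `h` and every configuration `U`, the new history `h′ = h ⌢ P_k(U)` (P_k(U) = `largeSet`) projects to `h` and has
`stepWeight(h′)(U) · chiB(h′)(U) = 1` with `chiB` AT THE DECOMPOSITION THRESHOLD `εL k` (v5) — large on `P_k(U)` by definition, small
(`< εL k`, hence also `< εS k`) on every other plaquette of `Ω_k(h) ⊇ Λ_k(h′) ∪ Ω_{k+1}(h′)`.  Requires only the threshold ordering `εL k ≤ εS k` AT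
THIS STEP for the step weight's (40)-factor (for the lane: `g_kp(g_k) ≤ 2L²g_{k−1}p(g_{k−1})`, `k ≤ K`, seat p3's `eps1Of_le_epsSOf`; the `∀ k` form
would be unsatisfiable beyond the run — vacuity rule of lead batch 17). [cite: Balaban1985UV3, (7)–(8) pp.257–258 + (48)–(49) pp.267–268] -/
theorem stepWeight_mul_chiB_cover (k : ℕ) (hLS : εL k ≤ εS k) (h : Hist P k) (hh : Hist.Admissible M₁ Rcol k h)
    (U : GaugeField P k G) :
    (Hist.snoc h (largeSet M₁ Rcol εL k h U)).proj = h ∧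
      (1 : ℝ) ≤ stepWeight M₁ Rcol εL εS k (Hist.snoc h (largeSet M₁ Rcol εL k h U)) U *
        chiB M₁ Rcol εL k (Hist.snoc h (largeSet M₁ Rcol εL k h U)) U := by
  set h' := Hist.snoc h (largeSet M₁ Rcol εL k h U) with hh'
  have hproj : h'.proj = h := Hist.proj_snoc h _
  have hlast : h'.last = largeSet M₁ Rcol εL k h U := Hist.last_snoc h _
  refine ⟨hproj, ?_⟩
  -- small field off `P_k(U)` inside `Ω_k(h)`: below the decomposition threshold `εL k` (hence below `εS k`)
  have hsmallL : ∀ p : Plaq P k, p ∉ h'.last → plaqCover p ⊆ Omega M₁ Rcol k h k →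
      dist1 (GaugeField.plaqHol U p) < εL k := by
    intro p hp hcov
    rw [hlast, largeSet, Finset.mem_filter] at hp
    have : ¬ εL k ≤ dist1 (GaugeField.plaqHol U p) := fun H => hp ⟨Finset.mem_univ _, hcov, H⟩
    exact not_le.mp this
  have hsmall : ∀ p : Plaq P k, p ∉ h'.last → plaqCover p ⊆ Omega M₁ Rcol k h k →
      dist1 (GaugeField.plaqHol U p) < εS k := fun p hp hcov => lt_of_lt_of_le (hsmallL p hp hcov) hLS
  have hadm : Hist.Admissible M₁ Rcol (k + 1) h' := by
    refine ⟨by rw [hproj]; exact hh, fun p hp => ?_⟩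
    rw [hlast, largeSet, Finset.mem_filter] at hp
    rw [hproj]; exact hp.2.1
  have hw : stepWeight M₁ Rcol εL εS k h' U = 1 := by
    unfold stepWeight
    rw [if_pos]
    refine ⟨hadm, fun p hp => ?_, fun p hp hcov => hsmall p hp ?_⟩
    · rw [hlast, largeSet, Finset.mem_filter] at hp; exact hp.2.2
    · intro x hx
      have hx' := (hcov hx).1
      rwa [Omega_succ_of_le M₁ Rcol h' le_rfl, hproj] at hx'
  have hχ : chiB M₁ Rcol εL k h' U = 1 := by
    unfold chiB
    rw [if_pos]
    intro p hp hcov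
    refine hsmallL p hp fun x hx => ?_
    have hx' := hcov hx
    rwa [Omega_succ_of_le M₁ Rcol h' le_rfl, hproj] at hx'
  rw [hw, hχ, mul_one]

/-! ## §3 Measurability of the weights -/

section Measurability

variable [MeasurableSpace G] [RegularGaugeGroup G]

/-- The plaquette deviation `U ↦ |U(∂p) − 1|` is measurable (LQB `Missing.measurable_plaqHol`, `RegularGaugeGroup.measurable_dist1`). [folklore] -/
theorem measurable_dev {k : ℕ} (p : Plaq P k) : Measurable fun U : GaugeField P k G => dist1 (GaugeField.plaqHol U p) :=
  RegularGaugeGroup.measurable_dist1.comp (Missing.measurable_plaqHol p)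

open Classical in
/-- `chiB` is measurable (a finite conjunction of measurable strict inequalities). [folklore] -/
theorem measurable_chiB (k : ℕ) (h' : Hist P (k + 1)) : Measurable (chiB (G := G) M₁ Rcol εS k h') := by
  unfold chiB
  refine Measurable.ite (measurableSet_setOf.2 ?_) measurable_const measurable_const
  refine Measurable.forall fun p => Measurable.imp measurable_const (Measurable.imp measurable_const ?_)
  exact measurableSet_setOf.1 (measurableSet_lt (measurable_dev p) measurable_const)

open Classical in
/-- Seat p1's step weight `stepWeight` is measurable (a finite conjunction of measurable inequalities). [folklore] -/
theorem measurable_stepWeight (k : ℕ) (h' : Hist P (k + 1)) :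
    Measurable (stepWeight (G := G) M₁ Rcol εL εS k h') := by
  unfold stepWeight
  refine Measurable.ite (measurableSet_setOf.2 ?_) measurable_const measurable_const
  refine measurable_const.and ((Measurable.forall fun p => Measurable.imp measurable_const ?_).and
    (Measurable.forall fun p => Measurable.imp measurable_const (Measurable.imp measurable_const ?_)))
  · exact measurableSet_setOf.1 (measurableSet_le measurable_const (measurable_dev p))
  · exact measurableSet_setOf.1 (measurableSet_lt (measurable_dev p) measurable_const)

end Measurability

section Masses

variable [MeasurableSpace G] [HaarData G] (av : ∀ j, Averaging P j G)

/-- **`hcover` FOR THE CONSTRUCTED MASSES** (the form consumed by `Bound55Tower.transport_rho_le_lf_ae`): wherever `m_k(h, U) ≠ 0`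
(so `h` is admissible, `massRec_eq_zero_of_not_admissible`) some new history above `h` has full weight `stepWeight·chiB ≥ 1` (`chiB` at the
decomposition threshold `εL k`, v5). [cite: Balaban1985UV3, (7)–(8) pp.257–258] -/
theorem histWeights3_cover (k : ℕ) (hLS : εL k ≤ εS k) (h : Hist P k) (U : GaugeField P k G)
    (hm : (histWeights3 M₁ Rcol εL εS av).mass k h U ≠ 0) :
    ∃ h' : Hist P (k + 1), h'.proj = h ∧
      (1 : ℝ) ≤ stepWeight M₁ Rcol εL εS k h' U * chiB M₁ Rcol εL k h' U := by
  have hh : Hist.Admissible M₁ Rcol k h := by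
    by_contra hna
    exact hm (histWeights3_mass_eq_zero_of_not_admissible M₁ Rcol εL εS av k h U hna)
  exact ⟨_, stepWeight_mul_chiB_cover M₁ Rcol εL εS k hLS h hh U⟩

/-! ## §4 The transported weighted mass is below the next mass, dV-a.e., for every history -/

/-- The RN transport of the zero density vanishes dV-a.e. (`Measure.rnDeriv_zero`). [folklore] -/
theorem rnTransport_zero_ae (k : ℕ) (avg : GaugeField P k G → GaugeField P (k + 1) G) :
    rnTransport avg (fun _ : GaugeField P k G => (0 : ℝ)) =ᵐ[fieldMeasure P (k + 1) G] fun _ => (0 : ℝ) := by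
  have h0 : rnTransport avg (fun _ : GaugeField P k G => (0 : ℝ)) = rnDensity avg (fun _ => (0 : ℝ)) :=
    funext fun V => by simp only [rnTransport, if_pos (fun _ => le_refl (0 : ℝ))]
  rw [h0]
  have hpush : pushDensity avg (fun _ : GaugeField P k G => (0 : ℝ)) = 0 := by
    unfold pushDensity
    have hz : (fun U : GaugeField P k G => ENNReal.ofReal ((fun _ : GaugeField P k G => (0 : ℝ)) U)) = 0 := by
      funext U; simp
    rw [hz, withDensity_zero, Measure.map_zero]
  unfold rnDensity
  rw [hpush]
  filter_upwards [Measure.rnDeriv_zero (fieldMeasure P (k + 1) G)] with V hV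
  rw [hV]; simp

variable [RegularGaugeGroup G]

/-- **`hm₁` FOR THE CONSTRUCTED MASSES** (the form consumed by `Transport48.transport41_le_sum_ae` / `Bound55Tower`): for a measurable
HAAR-COMPATIBLE averaging (`map Ū_k dU = dV`, E6′) and EVERY new history `h′`,
`T_k[stepWeight(h′)·m_k(proj h′)] ≤ m_{k+1}(h′)` dV-a.e. — trivial history: `w = 1`, `m_k(triv) = 1`, `T_k 1 = 1 = m_{k+1}(triv)`
(seat p1's pin `massRec_triv`, `T_k[w·1] ≤ 1`); admissible non-trivial: `m_{k+1} = min 1 (T_k[w·m_k])` (`massRec_succ`) and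
`T_k[w·m_k] ≤ 1`; inadmissible: the weight vanishes, `T_k 0 = 0` a.e. [cite: Balaban1985UV3, (41) p.266 + (48) p.268] -/
theorem histWeights3_transport_le_mass_ae (k : ℕ) (havg : Measurable (av k).avg)
    (hmap : (fieldMeasure P k G).map (av k).avg = fieldMeasure P (k + 1) G) (h' : Hist P (k + 1)) :
    (rnTransport (av k).avg
        fun U => stepWeight M₁ Rcol εL εS k h' U * (histWeights3 M₁ Rcol εL εS av).mass k h'.proj U)
      ≤ᵐ[fieldMeasure P (k + 1) G] (histWeights3 M₁ Rcol εL εS av).mass (k + 1) h' := by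
  -- `T_k[w·m_k] ≤ 1` a.e. (needed in two of the three cases)
  have hle1 := Transport48.rnTransport_le_one_ae
    (φ := fun U => stepWeight M₁ Rcol εL εS k h' U * (histWeights3 M₁ Rcol εL εS av).mass k h'.proj U) havg hmap
    ((measurable_stepWeight M₁ Rcol εL εS k h').mul (measurable_massRec M₁ Rcol εL εS av k h'.proj))
    (fun U => mul_nonneg (stepWeight_nonneg M₁ Rcol εL εS k h' U) ((histWeights3 M₁ Rcol εL εS av).mass_nonneg k _ U))
    (fun U => by
      calc stepWeight M₁ Rcol εL εS k h' U * (histWeights3 M₁ Rcol εL εS av).mass k h'.proj U ≤ 1 * 1 :=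
            mul_le_mul (stepWeight_le_one M₁ Rcol εL εS k h' U) ((histWeights3 M₁ Rcol εL εS av).mass_le_one k _ U)
              ((histWeights3 M₁ Rcol εL εS av).mass_nonneg k _ U) zero_le_one
        _ = 1 := one_mul 1)
  by_cases ht : h' = Hist.triv P (k + 1)
  · subst ht
    filter_upwards [hle1] with V hV
    show _ ≤ massRec M₁ Rcol εL εS av (k + 1) (Hist.triv P (k + 1)) V
    rw [massRec_triv]
    exact hV
  by_cases hh : Hist.Admissible M₁ Rcol (k + 1) h'
  · filter_upwards [hle1] with V hV
    show _ ≤ massRec M₁ Rcol εL εS av (k + 1) h' V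
    rw [massRec_succ M₁ Rcol εL εS av k h' hh ht V]
    exact le_min hV le_rfl
  · have hL : ∀ V, (histWeights3 M₁ Rcol εL εS av).mass (k + 1) h' V = 0 := fun V =>
      histWeights3_mass_eq_zero_of_not_admissible M₁ Rcol εL εS av (k + 1) h' V hh
    have hint : (fun U => stepWeight M₁ Rcol εL εS k h' U * (histWeights3 M₁ Rcol εL εS av).mass k h'.proj U)
        = fun _ => (0 : ℝ) := funext fun U => by rw [stepWeight_of_not_admissible M₁ Rcol εL εS k hh U, zero_mul]
    rw [hint]
    filter_upwards [rnTransport_zero_ae k (av k).avg] with V hV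
    rw [hL V, hV]

/-- **THE PRINTED (UNTRUNCATED) MASS RECURSION, dV-a.e.** (ruling R-HAAR (2): the companion certifying that seat p1's `min 1`/`max 0`
version pins carry no content), for an admissible non-trivial history `h′` and a measurable Haar-compatible `Ū_k`:
`m_{k+1}(h′) = T_k[w_k(h′)·m_k(proj h′)]` dV-a.e. — print's «∫dV_k↾_{Z_k} δ(V̄_kV^{−1}) ζχ_k ⋯» of (41)/(48) with no truncation
(`massRec_succ` + `Transport48.min_one_rnTransport_ae`).  (Trivial history: `m = 1 = T_k[1]` a.e.; inadmissible: `m = 0 = T_k[0]` a.e.)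
[cite: Balaban1985UV3, (41) p.266 + (48) p.268] -/
theorem histWeights3_mass_succ_ae_of_map (k : ℕ) (havg : Measurable (av k).avg)
    (hmap : (fieldMeasure P k G).map (av k).avg = fieldMeasure P (k + 1) G) (h' : Hist P (k + 1))
    (hh : Hist.Admissible M₁ Rcol (k + 1) h') (ht : h' ≠ Hist.triv P (k + 1)) :
    (histWeights3 M₁ Rcol εL εS av).mass (k + 1) h' =ᵐ[fieldMeasure P (k + 1) G]
      rnTransport (av k).avg
        (fun U => stepWeight M₁ Rcol εL εS k h' U * (histWeights3 M₁ Rcol εL εS av).mass k h'.proj U) := by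
  have hmin := Transport48.min_one_rnTransport_ae
    (φ := fun U => stepWeight M₁ Rcol εL εS k h' U * (histWeights3 M₁ Rcol εL εS av).mass k h'.proj U) havg hmap
    ((measurable_stepWeight M₁ Rcol εL εS k h').mul (measurable_massRec M₁ Rcol εL εS av k h'.proj))
    (fun U => mul_nonneg (stepWeight_nonneg M₁ Rcol εL εS k h' U) ((histWeights3 M₁ Rcol εL εS av).mass_nonneg k _ U))
    (fun U => by
      calc stepWeight M₁ Rcol εL εS k h' U * (histWeights3 M₁ Rcol εL εS av).mass k h'.proj U ≤ 1 * 1 :=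
            mul_le_mul (stepWeight_le_one M₁ Rcol εL εS k h' U) ((histWeights3 M₁ Rcol εL εS av).mass_le_one k _ U)
              ((histWeights3 M₁ Rcol εL εS av).mass_nonneg k _ U) zero_le_one
        _ = 1 := one_mul 1)
  have heq : (histWeights3 M₁ Rcol εL εS av).mass (k + 1) h' = fun V => min 1 (rnTransport (av k).avg
      (fun U => stepWeight M₁ Rcol εL εS k h' U * (histWeights3 M₁ Rcol εL εS av).mass k h'.proj U) V) :=
    funext fun V => massRec_succ M₁ Rcol εL εS av k h' hh ht V
  rw [heq]
  exact hmin

omit [RegularGaugeGroup G] in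
/-- **THE TRIVIAL-HISTORY PIN MODIFIES A NULL SET** (ruling R-HAAR (3): companion of seat p1's `massRec_triv`): in the standing range
`k ≤ m + K` and for a measurable Haar-compatible `Ū_k`, the transported trivial-history weight is `1` dV-a.e.,
`T_k[w_k(triv)·m_k(triv)] = T_k[1] = 1` a.e. (`stepWeight_triv`, `massRec_triv`, `Transport48.isRT_one_of_map`) — so the recursive value
and the pinned value `m_{k+1}(triv) := 1` agree almost everywhere. [cite: Balaban1985UV3, (47) p.267 + p.272 L32–33] -/
theorem histWeights3_transport_triv_ae_eq_one {k : ℕ} (hk : k ≤ P.m + P.K) (havg : Measurable (av k).avg)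
    (hmap : (fieldMeasure P k G).map (av k).avg = fieldMeasure P (k + 1) G) :
    (rnTransport (av k).avg
        fun U => stepWeight M₁ Rcol εL εS k (Hist.triv P (k + 1)) U *
          (histWeights3 M₁ Rcol εL εS av).mass k (Hist.triv P (k + 1)).proj U)
      =ᵐ[fieldMeasure P (k + 1) G] fun _ => (1 : ℝ) := by
  have hone : (fun U => stepWeight M₁ Rcol εL εS k (Hist.triv P (k + 1)) U *
      (histWeights3 M₁ Rcol εL εS av).mass k (Hist.triv P (k + 1)).proj U) = fun _ => (1 : ℝ) := by
    funext U
    rw [stepWeight_triv M₁ Rcol εL εS hk U, Hist.proj_triv]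
    show 1 * massRec M₁ Rcol εL εS av k (Hist.triv P k) U = 1
    rw [massRec_triv, mul_one]
  rw [hone]
  exact RTAlgebra.IsRT.ae_eq (isRT_rnTransport_of_ac (AvgAC.of_map_eq havg hmap) _ (integrable_const _))
    (Transport48.isRT_one_of_map havg hmap) havg (integrable_const _) (integrable_rnTransport _ _ (integrable_const _))
    (integrable_const _)

end Masses

end Summit.QuantumFields.Balaban3D.Proofs.Bound55Masses

end
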